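import Mathlib
import HarnessLib

/-!
# Route `SwapVirialDeficit` (YangMills): WINDOW ARITHMETIC for the «sharp-sigma» line of the crux `SwapGluedStiffness` (stmt-QuantumFields-24197)

Stub `stub_windowArithmeticSigma : WindowArithmeticSigma` of the BC3 skeleton LINE «sharp-sigma» (planner ym-idea-4 g14, HOME
bc/g14-B/sigma/SwapGluedStiffness_sharp_birth.lean; critic RECORD 08:19Z): pure asymptotics on Laplace windows.  Given the sharp-law data
`a, K > 0`, `q ≥ 0`, `0 < θ ≤ 1`, `β₀`, put `a' := min (a/2) (θ/(4(q+4)))` and `β₁ := max (max 4 (2β₀)) R^{4/θ}`, `R := 18432K + 1`; then for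
`β ≥ β₁` and `1 ≤ L ≤ β^{a'}`:  `0 < β`, `β₀ ≤ β/2`;  every `x ≥ β/2` has `L ≤ x^a` (`β^{a/2} = (√β)^a ≤ (β/2)^a`, as in ✓`TwistedEquipartitionGlue.rpow_half_le_rpow_of_window`; re-derived inline to keep this file route-independent) and `x^{−θ} ≤ (β/2)^{−θ}`;
`K L^q (β/2)^{−θ} ≤ 18L⁴ − 2`; and `8√(K L^q (β/2)^{−θ}(18L⁴−2)) ≤ 1/4` — because `L^q·L⁴ ≤ β^{θ/4}`, `(β/2)^{−θ} ≤ β^{−θ/2}` (`√β ≤ β/2`),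
so `K L^q L⁴ (β/2)^{−θ} ≤ K β^{−θ/4} ≤ K/R < 1/18432`.  The statement below (`windowArithmeticSigma`) is the stub's Prop verbatim, so the
skeleton's stub closes by `exact windowArithmeticSigma`.

HONEST FRAMING: an S stub (bookkeeping) of an evidence skeleton (DRAFT-by-design second line); the heart `SharpSwapLaplace`, the crux 24197 and the
leaf are OPEN; no rung / summit statement is proved; the Yang–Mills mass gap is NOT proved.  THEOREMS ONLY (0 `def`, 0 `sorry`), standard axioms.
References: [cite: TomboulisYaffe1985]; [cite: Luscher1983, §2].
-/

set_option autoImplicit false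

noncomputable section

namespace Summit.QuantumFields.YangMills.Theorems.SwapVirialDeficit.SharpSigma

/-- ★★ **`WindowArithmeticSigma`** (the Prop of stub `stub_windowArithmeticSigma` of LINE «sharp-sigma» on crux stmt-QuantumFields-24197, verbatim).
No crux / rung / summit is proved; the YM mass gap is NOT proved. [cite: TomboulisYaffe1985] -/
theorem windowArithmeticSigma :
    ∀ a K q θ β₀ : ℝ, 0 < a → 0 < K → 0 ≤ q → 0 < θ → θ ≤ 1 → ∃ a' : ℝ, 0 < a' ∧ ∃ β₁ : ℝ, ∀ β : ℝ, β₁ ≤ β →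
      ∀ L : ℕ, 1 ≤ L → (L : ℝ) ≤ β ^ a' →
        0 < β ∧ β₀ ≤ β / 2 ∧
        (∀ x : ℝ, β / 2 ≤ x → (L : ℝ) ≤ x ^ a ∧ x ^ (-θ) ≤ (β / 2) ^ (-θ)) ∧
        K * (L : ℝ) ^ q * (β / 2) ^ (-θ) ≤ 18 * (L : ℝ) ^ 4 - 2 ∧
        8 * Real.sqrt (K * (L : ℝ) ^ q * (β / 2) ^ (-θ) * (18 * (L : ℝ) ^ 4 - 2)) ≤ 1 / 4 := by
  intro a K q θ β₀ ha hK hq hθ hθ1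
  set a' : ℝ := min (a / 2) (θ / (4 * (q + 4))) with ha'
  have hq4 : 0 < q + 4 := by linarith
  have ha'0 : 0 < a' := lt_min (by linarith) (by positivity)
  have ha'a : a' ≤ a / 2 := min_le_left _ _
  have ha'θ : a' * (q + 4) ≤ θ / 4 := by
    have h : a' ≤ θ / (4 * (q + 4)) := min_le_right _ _
    calc a' * (q + 4) ≤ θ / (4 * (q + 4)) * (q + 4) := mul_le_mul_of_nonneg_right h hq4.le
      _ = θ / 4 := by field_simp
  set R : ℝ := 18432 * K + 1 with hR
  have hR0 : 0 < R := by rw [hR]; positivity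
  refine ⟨a', ha'0, max (max 4 (2 * β₀)) (R ^ (4 / θ)), ?_⟩
  intro β hβ L hL hLa
  have hβ4 : 4 ≤ β := le_trans (le_trans (le_max_left _ _) (le_max_left _ _)) hβ
  have hββ₀ : 2 * β₀ ≤ β := le_trans (le_trans (le_max_right _ _) (le_max_left _ _)) hβ
  have hβR : R ^ (4 / θ) ≤ β := le_trans (le_max_right _ _) hβ
  have hβ0 : 0 < β := by linarith
  have hβ1 : 1 ≤ β := by linarith
  have hℓ1 : (1 : ℝ) ≤ (L : ℝ) := by exact_mod_cast hL
  have hℓ0 : (0 : ℝ) < (L : ℝ) := by linarith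
  have hℓ4 : (1 : ℝ) ≤ (L : ℝ) ^ 4 := one_le_pow₀ hℓ1
  -- `√β ≤ β/2` and `(β/2)^{−θ} ≤ β^{−θ/2}`
  have hsqrt : Real.sqrt β ≤ β / 2 := by
    have hs2 : 2 ≤ Real.sqrt β := by
      rw [show (2 : ℝ) = Real.sqrt 4 by rw [show (4:ℝ) = 2 ^ 2 by norm_num, Real.sqrt_sq (by norm_num)]]
      exact Real.sqrt_le_sqrt hβ4
    nlinarith [Real.mul_self_sqrt hβ0.le, Real.sqrt_nonneg β]
  have hsqrt0 : 0 < Real.sqrt β := Real.sqrt_pos.mpr hβ0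
  have hhalf : (β / 2) ^ (-θ) ≤ β ^ (-(θ / 2)) := by
    calc (β / 2) ^ (-θ) ≤ (Real.sqrt β) ^ (-θ) := Real.rpow_le_rpow_of_nonpos hsqrt0 hsqrt (by linarith)
      _ = β ^ (-(θ / 2)) := by
          rw [Real.sqrt_eq_rpow, ← Real.rpow_mul hβ0.le]; congr 1; ring
  -- `L^q · L⁴ ≤ β^{θ/4}`
  have hmono : (L : ℝ) ^ q * (L : ℝ) ^ 4 ≤ β ^ (θ / 4) := by
    have h1 : (L : ℝ) ^ q * (L : ℝ) ^ 4 = (L : ℝ) ^ (q + 4) := by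
      rw [Real.rpow_add hℓ0]; norm_cast
    rw [h1]
    calc (L : ℝ) ^ (q + 4) ≤ (β ^ a') ^ (q + 4) := Real.rpow_le_rpow hℓ0.le hLa hq4.le
      _ = β ^ (a' * (q + 4)) := (Real.rpow_mul hβ0.le _ _).symm
      _ ≤ β ^ (θ / 4) := Real.rpow_le_rpow_of_exponent_le hβ1 ha'θ
  -- `K L^q L⁴ (β/2)^{−θ} ≤ K β^{−θ/4} ≤ K / R`
  have hβθ4 : β ^ (-(θ / 4)) ≤ R⁻¹ := by
    have h1 : R ≤ β ^ (θ / 4) := by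
      calc R = (R ^ (4 / θ)) ^ (θ / 4) := by
            rw [← Real.rpow_mul hR0.le]; rw [show 4 / θ * (θ / 4) = 1 by field_simp]; exact (Real.rpow_one R).symm
        _ ≤ β ^ (θ / 4) := Real.rpow_le_rpow (Real.rpow_nonneg hR0.le _) hβR (by positivity)
    rw [Real.rpow_neg hβ0.le]
    exact inv_anti₀ hR0 h1
  have hLq0 : 0 < (L : ℝ) ^ q := Real.rpow_pos_of_pos hℓ0 q
  have hcore : K * (L : ℝ) ^ q * (L : ℝ) ^ 4 * (β / 2) ^ (-θ) ≤ K * R⁻¹ := by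
    have h1 : K * (L : ℝ) ^ q * (L : ℝ) ^ 4 * (β / 2) ^ (-θ) ≤ K * β ^ (θ / 4) * β ^ (-(θ / 2)) := by
      have := mul_le_mul hmono hhalf (Real.rpow_nonneg (by positivity) _) (Real.rpow_nonneg hβ0.le _)
      calc K * (L : ℝ) ^ q * (L : ℝ) ^ 4 * (β / 2) ^ (-θ) = K * ((L : ℝ) ^ q * (L : ℝ) ^ 4 * (β / 2) ^ (-θ)) := by ring
        _ ≤ K * (β ^ (θ / 4) * β ^ (-(θ / 2))) := mul_le_mul_of_nonneg_left this hK.le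
        _ = K * β ^ (θ / 4) * β ^ (-(θ / 2)) := by ring
    have h2 : β ^ (θ / 4) * β ^ (-(θ / 2)) = β ^ (-(θ / 4)) := by
      rw [← Real.rpow_add hβ0]; congr 1; ring
    calc K * (L : ℝ) ^ q * (L : ℝ) ^ 4 * (β / 2) ^ (-θ) ≤ K * β ^ (θ / 4) * β ^ (-(θ / 2)) := h1
      _ = K * β ^ (-(θ / 4)) := by rw [mul_assoc, h2]
      _ ≤ K * R⁻¹ := mul_le_mul_of_nonneg_left hβθ4 hK.le
  have hKR : K * R⁻¹ ≤ 1 / 18432 := by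
    rw [← div_eq_mul_inv, div_le_div_iff₀ hR0 (by norm_num), hR]
    linarith
  have hP0 : 0 ≤ K * (L : ℝ) ^ q * (β / 2) ^ (-θ) := by
    have := Real.rpow_nonneg (show (0:ℝ) ≤ β / 2 by positivity) (-θ); positivity
  -- the product without `L⁴` is also small (`L⁴ ≥ 1`)
  have hsmall : K * (L : ℝ) ^ q * (β / 2) ^ (-θ) ≤ 1 / 18432 := by
    calc K * (L : ℝ) ^ q * (β / 2) ^ (-θ) ≤ K * (L : ℝ) ^ q * (β / 2) ^ (-θ) * (L : ℝ) ^ 4 :=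
          le_mul_of_one_le_right hP0 hℓ4
      _ = K * (L : ℝ) ^ q * (L : ℝ) ^ 4 * (β / 2) ^ (-θ) := by ring
      _ ≤ 1 / 18432 := hcore.trans hKR
  refine ⟨hβ0, by linarith, fun x hx => ⟨?_, ?_⟩, ?_, ?_⟩
  · calc (L : ℝ) ≤ β ^ a' := hLa
      _ ≤ β ^ (a / 2) := Real.rpow_le_rpow_of_exponent_le hβ1 ha'a
      _ = (β ^ ((1 : ℝ) / 2)) ^ a := by rw [← Real.rpow_mul hβ0.le]; congr 1; ring
      _ = (Real.sqrt β) ^ a := by rw [Real.sqrt_eq_rpow]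
      _ ≤ (β / 2) ^ a := Real.rpow_le_rpow (Real.sqrt_nonneg _) hsqrt ha.le
      _ ≤ x ^ a := Real.rpow_le_rpow (by linarith) hx ha.le
  · exact Real.rpow_le_rpow_of_nonpos (by positivity) hx (by linarith)
  · linarith
  · have h18 : K * (L : ℝ) ^ q * (β / 2) ^ (-θ) * (18 * (L : ℝ) ^ 4 - 2) ≤ (1 / 32) ^ 2 := by
      calc K * (L : ℝ) ^ q * (β / 2) ^ (-θ) * (18 * (L : ℝ) ^ 4 - 2) ≤ K * (L : ℝ) ^ q * (β / 2) ^ (-θ) * (18 * (L : ℝ) ^ 4) :=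
            mul_le_mul_of_nonneg_left (by linarith) hP0
        _ = 18 * (K * (L : ℝ) ^ q * (L : ℝ) ^ 4 * (β / 2) ^ (-θ)) := by ring
        _ ≤ 18 * (1 / 18432) := mul_le_mul_of_nonneg_left (hcore.trans hKR) (by norm_num)
        _ = (1 / 32) ^ 2 := by norm_num
    have hsq : Real.sqrt (K * (L : ℝ) ^ q * (β / 2) ^ (-θ) * (18 * (L : ℝ) ^ 4 - 2)) ≤ 1 / 32 := by
      calc Real.sqrt (K * (L : ℝ) ^ q * (β / 2) ^ (-θ) * (18 * (L : ℝ) ^ 4 - 2)) ≤ Real.sqrt ((1 / 32) ^ 2) := Real.sqrt_le_sqrt h18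
        _ = 1 / 32 := Real.sqrt_sq (by norm_num)
    linarith

end Summit.QuantumFields.YangMills.Theorems.SwapVirialDeficit.SharpSigma

end
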